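import Literature.NumberTheory.LFunctions.WeilLogLatticeCombNorm
import Mathlib.Analysis.Calculus.BumpFunction.InnerProduct
import Mathlib.MeasureTheory.Group.Integral
import HarnessLib

/-!
# The autocorrelation of a real bump

Topic `Literature/NumberTheory/LFunctions`.  For the `ζ`-mollified resonator combs of
`Literature/NumberTheory/LFunctions/WeilCombZeroSide.lean` built from a REAL bump `b` (smooth,
`0 ≤ b`, supported in `[-1, 1]`), the autocorrelation `K = g ⋆ g̃` of the comb is a real linear
combination of values of the autocorrelation `B(v) = ∫ b(u) b(u - v) du` of the bump.  This file
records `B` and its properties in the shape consumed by the node-weight evaluation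
(`Literature/NumberTheory/LFunctions/WeilCombNodeWeightsNode.lean`):

* `exists_real_bump` — a smooth `0 ≤ b ≤ 1` with `tsupport b ⊆ [-1, 1]` and `∫ b² > 0`;
* `weilConv_ofReal_eq` — `(b ⋆ b̃)(v) = ∫ b(u) b(u - v) du` for the complexified bump;
* `autocorr_contDiff`, `autocorr_eq_zero`, `autocorr_neg`, `autocorr_nonneg`, `autocorr_zero` —
  `B` is smooth, vanishes for `|v| > 2`, is even, nonnegative, `B(0) = ∫ b²`;
* `autocorr_package` — the `C²` package: `HasDerivAt` for `B, B'` and bounds `N₀, N₁, N₂`.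

Everything is proved; no named facts.
-/

noncomputable section

open MeasureTheory Set Complex
open scoped ComplexConjugate ContDiff

namespace Literature.NumberTheory.LFunctions

/-! ## A real nonnegative bump -/

/-- There is a smooth real bump `0 ≤ b ≤ 1` with `tsupport b ⊆ [-1, 1]` and `∫ b² > 0`
(Mathlib's `ContDiffBump` with radii `1/2 < 1`). [folklore] -/
theorem exists_real_bump :
    ∃ b : ℝ → ℝ, ContDiff ℝ ∞ b ∧ HasCompactSupport b ∧ tsupport b ⊆ Icc (-1) 1 ∧
      (∀ x, 0 ≤ b x) ∧ (∀ x, b x ≤ 1) ∧ 0 < ∫ x, b x ^ 2 := by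
  let β : ContDiffBump (0 : ℝ) := ⟨1 / 2, 1, by norm_num, by norm_num⟩
  refine ⟨β, β.contDiff, β.hasCompactSupport, ?_, fun x ↦ β.nonneg, fun x ↦ β.le_one, ?_⟩
  · rw [β.tsupport_eq, Real.closedBall_eq_Icc, zero_sub, zero_add]
  · have hcont : Continuous fun x ↦ β x ^ 2 := β.continuous.pow 2
    have hcs : HasCompactSupport fun x ↦ β x ^ 2 := by
      have : (fun x ↦ β x ^ 2) = fun x ↦ β x * β x := by funext x; ring
      rw [this]; exact β.hasCompactSupport.mul_right
    refine hcont.integral_pos_of_hasCompactSupport_nonneg_nonzero hcs (fun x ↦ sq_nonneg _)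
      (x := 0) ?_
    have : β 0 = 1 := β.one_of_mem_closedBall (Metric.mem_closedBall_self (by norm_num))
    rw [this]; norm_num

/-! ## The autocorrelation of a real bump -/

/-- The autocorrelation of the complexified bump is the real autocorrelation:
`(b ⋆ b̃)(v) = ∫ b(u) b(u - v) du`. [folklore] -/
theorem weilConv_ofReal_eq (b : ℝ → ℝ) (v : ℝ) :
    weilConv (fun t ↦ ((b t : ℝ) : ℂ)) (weilReflect fun t ↦ ((b t : ℝ) : ℂ)) v
      = ((∫ u, b u * b (u - v) : ℝ) : ℂ) := by
  rw [weilConv_apply, ← integral_complex_ofReal]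
  congr 1 with u
  simp only [weilReflect, Complex.conj_ofReal, neg_sub]
  push_cast
  ring

/-- A real function supported in `[-1, 1]` vanishes at `x` with `|x| > 1`. [folklore] -/
theorem real_eq_zero_of_one_lt_abs {b : ℝ → ℝ} (hsupp : tsupport b ⊆ Icc (-1) 1) {x : ℝ}
    (hx : 1 < |x|) : b x = 0 := by
  apply image_eq_zero_of_notMem_tsupport
  intro h
  have h' := hsupp h
  rw [mem_Icc] at h'
  have := abs_le.2 ⟨h'.1, h'.2⟩
  linarith

section Autocorr

variable {b : ℝ → ℝ}

/-- The autocorrelation of a smooth compactly supported real bump is smooth. [folklore] -/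
theorem autocorr_contDiff (hb : ContDiff ℝ ∞ b) (hbc : HasCompactSupport b) :
    ContDiff ℝ ∞ (fun v ↦ ∫ u, b u * b (u - v)) := by
  have hb₁ : IsWeilTest (fun t ↦ ((b t : ℝ) : ℂ)) :=
    ⟨ofRealCLM.contDiff.comp hb, hbc.comp_left Complex.ofReal_zero⟩
  have hK := hb₁.weilConv hb₁.weilReflect
  have he : (fun v ↦ ∫ u, b u * b (u - v))
      = fun v ↦ (weilConv (fun t ↦ ((b t : ℝ) : ℂ)) (weilReflect fun t ↦ ((b t : ℝ) : ℂ)) v).re := by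
    funext v; rw [weilConv_ofReal_eq, Complex.ofReal_re]
  rw [he]
  exact reCLM.contDiff.comp hK.1

/-- The autocorrelation of a bump supported in `[-1, 1]` vanishes for `|v| > 2`. [folklore] -/
theorem autocorr_eq_zero (hbs : tsupport b ⊆ Icc (-1) 1) {v : ℝ} (hv : 2 < |v|) :
    ∫ u, b u * b (u - v) = 0 := by
  have hpt : ∀ u, b u * b (u - v) = 0 := by
    intro u
    by_cases hu : |u| ≤ 1
    · have h1 : 1 < |u - v| := by
        have := abs_sub_abs_le_abs_sub v u
        rw [abs_sub_comm] at this
        linarith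
      rw [real_eq_zero_of_one_lt_abs hbs h1, mul_zero]
    · rw [real_eq_zero_of_one_lt_abs hbs (not_le.1 hu), zero_mul]
  simp [hpt]

/-- The autocorrelation has compact support. [folklore] -/
theorem autocorr_hasCompactSupport (hbs : tsupport b ⊆ Icc (-1) 1) :
    HasCompactSupport (fun v ↦ ∫ u, b u * b (u - v)) := by
  refine HasCompactSupport.intro (isCompact_Icc (a := (-2 : ℝ)) (b := 2)) fun v hv ↦ ?_
  apply autocorr_eq_zero hbs
  simp only [mem_Icc, not_and_or, not_le] at hv
  rcases hv with hv | hv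
  · exact lt_of_lt_of_le (by linarith) (neg_le_abs v)
  · exact lt_of_lt_of_le hv (le_abs_self v)

/-- The autocorrelation of a real bump is even. [folklore] -/
theorem autocorr_neg (b : ℝ → ℝ) (v : ℝ) : ∫ u, b u * b (u - -v) = ∫ u, b u * b (u - v) := by
  have h := integral_sub_right_eq_self (fun w ↦ b (w + v) * b w) (μ := volume) v
  simp only [sub_add_cancel] at h
  rw [h]
  simp only [sub_neg_eq_add]
  refine integral_congr_ae (Filter.Eventually.of_forall fun w ↦ ?_)
  simp only [mul_comm]

/-- The autocorrelation of a nonnegative bump is nonnegative. [folklore] -/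
theorem autocorr_nonneg (hb0 : ∀ x, 0 ≤ b x) (v : ℝ) : 0 ≤ ∫ u, b u * b (u - v) :=
  integral_nonneg fun _ ↦ mul_nonneg (hb0 _) (hb0 _)

/-- At the origin the autocorrelation is `∫ b²`. [folklore] -/
theorem autocorr_zero (b : ℝ → ℝ) : ∫ u, b u * b (u - 0) = ∫ u, b u ^ 2 := by
  refine integral_congr_ae (Filter.Eventually.of_forall fun u ↦ ?_)
  simp only [sub_zero, sq]

/-- **The `C²` package of the autocorrelation.** For a smooth real bump `b ≥ 0` supported in
`[-1,1]`, `B(v) = ∫ b(u) b(u-v) du` with `B' = deriv B`, `B'' = deriv B'` satisfies: `HasDerivAt`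
everywhere for `B` and `B'`, bounds `|B| ≤ N₀`, `|B'| ≤ N₁`, `|B''| ≤ N₂`, `B(x) = 0` for
`|x| > 2`, `B ≥ 0`. [folklore] -/
theorem autocorr_package (hb : ContDiff ℝ ∞ b) (hbc : HasCompactSupport b)
    (hbs : tsupport b ⊆ Icc (-1) 1) (hb0 : ∀ x, 0 ≤ b x) :
    ∃ N₀ N₁ N₂ : ℝ,
      (∀ x, HasDerivAt (fun v ↦ ∫ u, b u * b (u - v)) (deriv (fun v ↦ ∫ u, b u * b (u - v)) x) x) ∧
      (∀ x, HasDerivAt (deriv (fun v ↦ ∫ u, b u * b (u - v)))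
        (deriv (deriv (fun v ↦ ∫ u, b u * b (u - v))) x) x) ∧
      (∀ x, |(fun v ↦ ∫ u, b u * b (u - v)) x| ≤ N₀) ∧
      (∀ x, |deriv (fun v ↦ ∫ u, b u * b (u - v)) x| ≤ N₁) ∧
      (∀ x, |deriv (deriv (fun v ↦ ∫ u, b u * b (u - v))) x| ≤ N₂) ∧
      (∀ x, 2 < |x| → (fun v ↦ ∫ u, b u * b (u - v)) x = 0) ∧
      (∀ x, 0 ≤ (fun v ↦ ∫ u, b u * b (u - v)) x) := by
  set B : ℝ → ℝ := fun v ↦ ∫ u, b u * b (u - v) with hB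
  have hBd : ContDiff ℝ ∞ B := autocorr_contDiff hb hbc
  have hBc : HasCompactSupport B := autocorr_hasCompactSupport hbs
  obtain ⟨hdiff, hB'd⟩ := contDiff_infty_iff_deriv.1 hBd
  obtain ⟨hdiff', hB''d⟩ := contDiff_infty_iff_deriv.1 hB'd
  have hB'c : HasCompactSupport (deriv B) := hBc.deriv
  have hB''c : HasCompactSupport (deriv (deriv B)) := hB'c.deriv
  obtain ⟨N₀, hN₀⟩ := hBd.continuous.bounded_above_of_compact_support hBc
  obtain ⟨N₁, hN₁⟩ := hB'd.continuous.bounded_above_of_compact_support hB'c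
  obtain ⟨N₂, hN₂⟩ := hB''d.continuous.bounded_above_of_compact_support hB''c
  refine ⟨N₀, N₁, N₂, fun x ↦ (hdiff x).hasDerivAt, fun x ↦ (hdiff' x).hasDerivAt,
    fun x ↦ by simpa [Real.norm_eq_abs] using hN₀ x, fun x ↦ by simpa [Real.norm_eq_abs] using hN₁ x,
    fun x ↦ by simpa [Real.norm_eq_abs] using hN₂ x, fun x hx ↦ autocorr_eq_zero hbs hx,
    fun x ↦ autocorr_nonneg hb0 x⟩

end Autocorr

end Literature.NumberTheory.LFunctions
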